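import Summits.KontsevichZagierPeriods.KontsevichZagierPeriods.Theorems.LiouvilleUnfoldingAyoubPiCancellationDictionary
import Summits.KontsevichZagierPeriods.KontsevichZagierPeriods.Theorems.LiouvilleUnfoldingAyoubPiCancellationSpreadReductionIff

/-!
# Crux stmt-KontsevichZagierPeriods-0540 (`LiouvilleUnfolding.AyoubPiCancellation` ≡ `KZ.PiCancellation`) —
# line `Sketch` (idea `moving-segment-wronskian`), skeleton v10 (lead seat c2, 2026-08-17)

v10 (seat c2): body byte-identical to v9; re-checked (`lean check` rc 0, sorries = {`stub_fluxFamilyVanishing`},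
audit: `AyoubPiCancellation_proof` concludes the crux BY NAME) and re-registered by the continuation lead c2, who
found the line CLOSED MODULO THE CRUX — its one open stub is tree-equivalent to item 0540
(`stub_spreadReductionIff`, p154361) — and declared the line dead (`Lines/Sketch.dead.md`).

v9 (seat c1, after waves 1–2). Everything provable in the line has LANDED; the skeleton is now the bare
composition  (B) ⟹ crux  with (B) `stub_fluxFamilyVanishing` the ONLY registered open stub, and
(B) ⟺ crux is a TREE THEOREM (`stub_spreadReductionIff` / `fluxFamilyVanishing_iff_piCancellation`, p154361, from
the two landed bookkeeping stubs `stub_spreadFinishing` p153037 and `stub_spreadOfRelation` p153694).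

Summary of the line's mathematics (details: `Cruxes/AyoubPiCancellation/NOTES.md` §c1, and the module
docstrings of the landed files `Theorems/LiouvilleUnfoldingAyoubPiCancellation*.lean`):
* objects: the pinned MOVING-SEGMENT SPREAD family over the wall positions `q ∈ (a, b)`,
  `V n r = [{(q, x, y, w) : a < q < b, x² + y² ≤ 1, x < q, w ∈ σ_r}, g_r(w)]` (dim `n + 3`, coordinate
  `0 = q`; `exists_pinnedSpread`);
* (A') SPREAD FINISHING (`stub_spreadFinishing`, PROVED): a `q`-fibred certificate of `V ⊗ c` over any
  interval containing an interior one forces `c ∈ relations` — weight multiplier with the ZERO-MEAN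
  weight `h = d/dq [𝟙_(a',b')(q)(q − a')(q − b')/(2√(1 − q²))]` (`stub_spreadWeight` p145443,
  `stub_spreadLift` p148297), whose weighted spread solid is worth `(b' − a')³/6 ≠ 0` against every
  factor (`stub_spreadSolidReduce` p150192, `stub_spreadPlaneReduce` p151731, `stub_spreadSegmentConst`
  p152235); the idea card's derivative engine (seat 0's stub (A1), XL) is unnecessary and withdrawn;
* converse bookkeeping (`stub_spreadOfRelation`, PROVED): the spread of a relation is `q`-fibred;
* (B) `stub_fluxFamilyVanishing` (OPEN, ≡ crux): `[π]·c ∈ relations ⇒` the spread of `c` is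
  `q`-fibred-null on some interval. Seat 0's side theorems (strip / slab-fibred / strip-weight / band
  reductions, exterior annihilation: p140510 p143360 p143710 p141674 p142310) remain valid certificate
  classes for 0540.

Composition (`AyoubPiCancellation_of`): (B) ⟹ `KZ.PiCancellation` (`fluxFamilyVanishing_iff_piCancellation`)
⟹ `AyoubPiCancellation` by the tree's dictionary `ayoubPiCancellation_iff_piCancellation` (p136015).
-/

noncomputable section

-- `Summit.KontsevichZagierPeriods.KontsevichZagierPeriods.…` is the tree's mandated layout (single-conjunct summit).
set_option linter.dupNamespace false

namespace Summit.KontsevichZagierPeriods.KontsevichZagierPeriods.AyoubPiCancellationLine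

open Set MeasureTheory
open Literature.NumberTheory.Transcendental
open Literature.NumberTheory.Transcendental.KZ

/-! ## Registered stubs -/

/-! Landed (tree theorems, imported, same namespace): wave 1 (seat c1) `stub_spreadWeight` p145443,
`stub_spreadLift` p148297, `stub_spreadSolidReduce` p150192, `stub_spreadPlaneReduce` p151731,
`stub_spreadSegmentConst` p152235; `stub_spreadFinishing` p153037 (file `…SpreadFinishing.lean`);
wave 2 `stub_spreadOfRelation` p153694 (file `…SpreadOfRelation.lean`). Seat 0: `stub_stripWeight`
p139589, `stub_stripConst` p140187, `stub_bandLift` p140314, `stub_stripDescent` p140510,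
`stub_bandFinishing` p140774, `stub_bandReductionIff` p141674, `stub_exteriorAnnihilation` p142310,
`stub_slabFibredDescent` p143360, `stub_stripWeightDescent` p143710. -/

/-- STUB `stub_fluxFamilyVanishing` (≡ crux 0540, by `fluxFamilyVanishing_iff_piCancellation`) — **(B), the
flux family vanishes on some interval of wall positions**: every `c` with `[π]·c ∈ relations` has its
moving-segment spread annihilated UNIFORMLY (a `q`-fibred relation) on SOME interval `(a, b)` of wall
positions, `-1 ≤ a < b ≤ 1`. The card's programme: Morse sweep of a rotated certificate, finitely many
sweep events, cancellation of flux births as families, affine flux germs along the fixed loci of the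
wall-crossing substitutions. [folklore] -/
theorem stub_fluxFamilyVanishing : ∀ c : FormalRep, of piRep * c ∈ relations →
    ∃ a b : ℚ, -1 ≤ a ∧ a < b ∧ b ≤ 1 ∧
      ∀ (V : ∀ n : ℕ, IntegralRep n → IntegralRep (n + 3)),
        (∀ (n : ℕ) (r : IntegralRep n),
          (V n r).domain = {z : Fin (n + 3) → ℝ | ((a : ℝ) < z 0 ∧ z 0 < b) ∧ z 1 ^ 2 + z 2 ^ 2 ≤ 1 ∧
            z 1 < z 0 ∧ (fun i : Fin n => z i.succ.succ.succ) ∈ r.domain} ∧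
          (V n r).integrand = fun z => r.integrand (fun i : Fin n => z i.succ.succ.succ)) →
        FreeAbelianGroup.lift (fun s : (Σ n, IntegralRep n) => of (V s.1 s.2)) c ∈ fibredRelations := by
  sorry

/-! ## Glue (sorry-free): the crux by name -/

/-! Landed glue (imported): `exists_pinnedSpread`, `fluxFamilyVanishing_iff_piCancellation` and the registered
side stub `stub_spreadReductionIff` ((B) ⟺ `AyoubPiCancellation`) — file `…SpreadReductionIff.lean` (p154361). -/

/-- **The stubs compose to `KZ.PiCancellation`**: (B) and `fluxFamilyVanishing_iff_piCancellation`.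
[folklore] -/
theorem piCancellation_of_stubs : PiCancellation :=
  fluxFamilyVanishing_iff_piCancellation.1 stub_fluxFamilyVanishing

/-- **The line concludes the crux BY NAME**: item stmt-KontsevichZagierPeriods-0540 in route
LiouvilleUnfolding's typing, from the stub, through the tree's dictionary
`LiouvilleUnfolding.PiLocalisation.ayoubPiCancellation_iff_piCancellation` (p136015). [folklore] -/
theorem AyoubPiCancellation_of :
    Summit.KontsevichZagierPeriods.KontsevichZagierPeriods.Theses.LiouvilleUnfolding.AyoubPiCancellation :=
  Summit.KontsevichZagierPeriods.LiouvilleUnfolding.PiLocalisation.ayoubPiCancellation_iff_piCancellation.2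
    piCancellation_of_stubs

/-- **The crux in the typing the ledger files it under** (route AyoubSpecialisation's copy of item 0540 —
the same body, `LiouvilleUnfolding.PiLocalisation.ayoubPiCancellation_iff_ayoubSpecialisation` is
`Iff.rfl`). [folklore] -/
theorem AyoubPiCancellation_proof :
    Summit.KontsevichZagierPeriods.KontsevichZagierPeriods.Theses.AyoubSpecialisation.AyoubPiCancellation :=
  Summit.KontsevichZagierPeriods.LiouvilleUnfolding.PiLocalisation.ayoubPiCancellation_iff_ayoubSpecialisation.1
    AyoubPiCancellation_of

end Summit.KontsevichZagierPeriods.KontsevichZagierPeriods.AyoubPiCancellationLine
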